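import Literature.Geometry.Lorentzian.LorentzBoost

/-!
# `NeckGapDecay` (crux stmt-FinalStateConjecture-16768, route StarvedNecks) — negative side, stub hypotheses:
# the two kinematic hypotheses of stub S3a `BandAnchoredPaths` (line `Sketch`) are load-bearing

Refuter seat `refuter-cdisprove-stmt-FinalStateConjecture-16768-0` (crux disprover, 2026-08-17), `-- Targets`.
Stub S3a of the lead's skeleton `Cruxes/NeckGapDecay/Lines/Sketch.lean` (`ConnectionLevelCones.BandAnchoredPaths`)
says: on a boosted Kerr background with ORTHOCHRONOUS label `Λ` and a MONOTONE wall `W`, every point of the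
band `{τ₁ ≤ t, R₁ + ½ ≤ r ≤ W(x⁰)}` lies on a preconnected coordinate set inside the band meeting the anchor
sphere `{r = R₁ + ½}`.  It is TRUE as registered (paper: move along `+Λe₀`, then inward in the rest frame
while advancing rest time at rate `≥ |v|`, so that lab time never decreases).  This file shows that NEITHER
hypothesis can be dropped — small explicit models, `M = a = 0` (so `r = ‖x̄′‖`, `r₊ = 0`), lab velocity
`v = (3/5, 0, 0)` (`γ = 5/4`), `R₁ = 10`, `τ₁ = 0`, the band point `x = Λ x′`, `x′ = (0, −1000, 0, 0)`:

* `not_bandAnchoredPaths_without_orthochronous` : with the NON-orthochronous label `Λ = (−1)·boost(v)`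
  (`(Λw)⁰ = −(5/4)w′⁰ − (3/4)w′¹` in rest coordinates `w′`) and the monotone step wall `W = 2` below lab time
  `750 = x⁰`, `W = 10⁶` from `750` on: a band point `z` needs `W(z⁰) ≥ r(z) ≥ 10.5 > 2`, i.e. `z⁰ ≥ 750`,
  i.e. `−(5/4)z′⁰ − (3/4)z′¹ ≥ 750` with `z′⁰ ≥ 0`, forcing `z′¹ ≤ −1000` and `r(z) ≥ 1000` — no point of
  the anchor sphere `r = 10.5` qualifies.
* `not_bandAnchoredPaths_without_monotone` : with the orthochronous `Λ = boost(v)` but the NON-monotone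
  spike wall `W(−750) = 10⁶`, `W = 0` elsewhere (`x⁰ = −750`): a band point needs `z⁰ = −750`, i.e.
  `(5/4)(z′⁰ + (3/5)z′¹) = −750` with `z′⁰ ≥ 0`, again `z′¹ ≤ −1000`.

So any proof of S3a must use both `0 < (Λe₀)⁰` and `Monotone W` (the physics stub P feeds S3a a wall from
S1, which is monotone, and `Hc`(1) supplies orthochronous labels — consistent).  No Theses statement is
asserted or negated.  References: O'Neill 1983, Ch. 9, pp. 233–236 (boosts); Jackson (11.19).
-/

noncomputable section

open TopologicalSpace Filter Topology Set Function
open scoped Topology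

namespace Summit.FinalStateConjecture.FinalStateConjecture.Theorems.NeckGapDecay.Negative

open Literature.Geometry.Lorentzian

set_option linter.dupNamespace false

/-- Stub S3a of `Lines/Sketch.lean` WITHOUT the orthochronous hypothesis `0 < (Λe₀)⁰` (otherwise verbatim).
[topic: Summits/FinalStateConjecture/FinalStateConjecture — route StarvedNecks, crux NeckGapDecay, line Sketch] -/
def BandAnchoredPathsWithoutOrthochronous : Prop :=
  ∀ (Λ : lorentzGroup) (c : E4) (M a : ℝ) (W : ℝ → ℝ) (R₁ τ₁ : ℝ),
    Monotone W → max (Kerr.rPlus M a) 0 < R₁ + 1 / 2 →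
    let B := boostedKerrBackground Λ c M a
    ∀ x : B.domain, τ₁ ≤ B.time x.1 → R₁ + 1 / 2 ≤ B.radius x.1 → B.radius x.1 ≤ W (x.1 0) →
      ∃ S : Set E4, IsPreconnected S ∧ S ⊆ (B.domain : Set E4) ∧ x.1 ∈ S ∧
        (∀ z ∈ S, τ₁ ≤ B.time z ∧ R₁ + 1 / 2 ≤ B.radius z ∧ B.radius z ≤ W (z 0)) ∧
        ∃ y ∈ S, B.radius y = R₁ + 1 / 2

/-- Stub S3a of `Lines/Sketch.lean` WITHOUT the hypothesis `Monotone W` (otherwise verbatim).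
[topic: Summits/FinalStateConjecture/FinalStateConjecture — route StarvedNecks, crux NeckGapDecay, line Sketch] -/
def BandAnchoredPathsWithoutMonotone : Prop :=
  ∀ (Λ : lorentzGroup) (c : E4) (M a : ℝ) (W : ℝ → ℝ) (R₁ τ₁ : ℝ),
    0 < (Λ : E4 ≃L[ℝ] E4) (E4.basisVector 0) 0 → max (Kerr.rPlus M a) 0 < R₁ + 1 / 2 →
    let B := boostedKerrBackground Λ c M a
    ∀ x : B.domain, τ₁ ≤ B.time x.1 → R₁ + 1 / 2 ≤ B.radius x.1 → B.radius x.1 ≤ W (x.1 0) →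
      ∃ S : Set E4, IsPreconnected S ∧ S ⊆ (B.domain : Set E4) ∧ x.1 ∈ S ∧
        (∀ z ∈ S, τ₁ ≤ B.time z ∧ R₁ + 1 / 2 ≤ B.radius z ∧ B.radius z ≤ W (z 0)) ∧
        ∃ y ∈ S, B.radius y = R₁ + 1 / 2

namespace BandModel

/-! ### The explicit boost `v = (3/5, 0, 0)`, `γ = 5/4` -/

/-- The lab velocity `v = (3/5, 0, 0)`. -/
def v35 : E3 := EuclideanSpace.single 0 (3 / 5 : ℝ)

/-- `‖v‖ = 3/5`. [folklore] -/
theorem norm_v35 : ‖v35‖ = 3 / 5 := by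
  simp [v35]

/-- `‖v‖ < 1`. [folklore] -/
theorem norm_v35_lt_one : ‖v35‖ < 1 := by rw [norm_v35]; norm_num

/-- `γ(v) = 5/4`. [folklore] -/
theorem gamma_v35 : Lorentz.gamma v35 = 5 / 4 := by
  rw [Lorentz.gamma, norm_v35, show (1 : ℝ) - (3 / 5) ^ 2 = (4 / 5) ^ 2 by norm_num,
    Real.sqrt_sq (by norm_num)]
  norm_num

/-- `⟪v, w̄⟫ = (3/5) w¹`. [folklore] -/
theorem inner_v35 (w : E4) : inner ℝ v35 (E4.spatial w) = 3 / 5 * w 1 := by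
  rw [v35, EuclideanSpace.inner_single_left]
  simp [E4.spatial_apply]

/-- Time component of the boost in rest coordinates: `(boost w)⁰ = (5/4) w⁰ + (3/4) w¹`. [folklore] -/
theorem boost_apply_zero (w : E4) :
    ((Lorentz.boost v35 norm_v35_lt_one : E4 ≃L[ℝ] E4) w) 0 = 5 / 4 * w 0 + 3 / 4 * w 1 := by
  rw [Lorentz.coe_boost_apply, Lorentz.boostCLM_apply_zero, gamma_v35, inner_v35]
  ring

/-- Negation preserves the Minkowski form (local copy of a landed computation, kept private). [folklore] -/
private theorem neg_mem_lorentzGroup' : (ContinuousLinearEquiv.neg ℝ : E4 ≃L[ℝ] E4) ∈ lorentzGroup :=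
  fun v w ↦ by simp only [ContinuousLinearEquiv.neg_apply, map_neg, neg_neg, neg_apply]

/-- The orthochronous label `Λ₊ = boost(v)`. -/
def Λpos : lorentzGroup := Lorentz.boost v35 norm_v35_lt_one

/-- The NON-orthochronous label `Λ₋ = (−1)·boost(v)`. -/
def Λneg : lorentzGroup := ⟨ContinuousLinearEquiv.neg ℝ, neg_mem_lorentzGroup'⟩ * Lorentz.boost v35 norm_v35_lt_one

/-- `(Λ₊ w)⁰ = (5/4) w⁰ + (3/4) w¹`. [folklore] -/
theorem Λpos_apply_zero (w : E4) : ((Λpos : E4 ≃L[ℝ] E4) w) 0 = 5 / 4 * w 0 + 3 / 4 * w 1 :=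
  boost_apply_zero w

/-- `(Λ₋ w)⁰ = −(5/4) w⁰ − (3/4) w¹`. [folklore] -/
theorem Λneg_apply_zero (w : E4) : ((Λneg : E4 ≃L[ℝ] E4) w) 0 = -(5 / 4 * w 0) - 3 / 4 * w 1 := by
  show ((ContinuousLinearEquiv.neg ℝ : E4 ≃L[ℝ] E4) ((Lorentz.boost v35 norm_v35_lt_one : E4 ≃L[ℝ] E4) w)) 0 = _
  rw [ContinuousLinearEquiv.neg_apply, PiLp.neg_apply, boost_apply_zero]
  ring

/-- `Λ₊` is orthochronous: `(Λ₊ e₀)⁰ = 5/4 > 0`. [folklore] -/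
theorem Λpos_orthochronous : 0 < ((Λpos : E4 ≃L[ℝ] E4) (E4.basisVector 0)) 0 := by
  rw [Λpos_apply_zero]
  simp

/-! ### The band point `x = Λ x′`, `x′ = (0, −1000, 0, 0)` -/

/-- Rest coordinates of the band point: `x′ = (0, −1000, 0, 0)`. -/
def xr : E4 := E4.ofTimeSpace 0 (EuclideanSpace.single 0 (-1000 : ℝ))

/-- `x′⁰ = 0`. [folklore] -/
theorem xr_zero : xr 0 = 0 := E4.ofTimeSpace_apply_zero _ _
/-- `x′¹ = −1000`. [folklore] -/
theorem xr_one : xr 1 = -1000 := by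
  show xr (Fin.succ 0) = -1000
  rw [xr, E4.ofTimeSpace_apply_succ]
  simp
/-- `r(x′) = 1000` for `a = 0`. [folklore] -/
theorem radius_xr : Kerr.radius 0 xr = 1000 := by
  rw [Kerr.radius_zero_left, xr, E4.spatialNorm_ofTimeSpace]
  simp

/-- `r₊(0, 0) = 0`, so `max r₊ 0 = 0 < 10 + ½`. [folklore] -/
theorem anchor_ok : max (Kerr.rPlus 0 0) 0 < (10 : ℝ) + 1 / 2 := by
  rw [Kerr.rPlus_zero_right le_rfl]; norm_num

variable (Λ : lorentzGroup)

/-- Rest coordinates of the lab point `Λ x′` are `x′` (trivial translation). [folklore] -/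
theorem poincareInv_apply : poincareInv Λ 0 ((Λ : E4 ≃L[ℝ] E4) xr) = xr := by
  rw [poincareInv, sub_zero, ContinuousLinearEquiv.symm_apply_apply]

/-- `Λ x′` lies in the boosted exterior of `(M, a) = (0, 0)`. [folklore] -/
theorem mem_domain : (Λ : E4 ≃L[ℝ] E4) xr ∈ (boostedKerrBackground Λ 0 0 0).domain := by
  show (Λ : E4 ≃L[ℝ] E4) xr ∈ boostedKerrExterior Λ 0 0 0
  rw [mem_boostedKerrExterior, poincareInv_apply, Kerr.mem_exterior, radius_xr, Kerr.rPlus_zero_right le_rfl]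
  norm_num

/-- Hole time of the band point is `0`. [folklore] -/
theorem time_x : (boostedKerrBackground Λ 0 0 0).time ((Λ : E4 ≃L[ℝ] E4) xr) = 0 := by
  show poincareInv Λ 0 ((Λ : E4 ≃L[ℝ] E4) xr) 0 = 0
  rw [poincareInv_apply, xr_zero]

/-- Hole radius of the band point is `1000`. [folklore] -/
theorem radius_x : (boostedKerrBackground Λ 0 0 0).radius ((Λ : E4 ≃L[ℝ] E4) xr) = 1000 := by
  show Kerr.radius 0 (poincareInv Λ 0 ((Λ : E4 ≃L[ℝ] E4) xr)) = 1000
  rw [poincareInv_apply, radius_xr]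

/-- Hole time and radius of a lab point `z` in terms of its rest coordinates `z′ = Λ⁻¹ z`: `t = z′⁰`,
`r = ‖z̄′‖ ≥ |z′¹|` (for `a = 0`), and `z = Λ z′`. [folklore] -/
theorem rest_coords (z : E4) :
    (boostedKerrBackground Λ 0 0 0).time z = ((Λ : E4 ≃L[ℝ] E4).symm z) 0 ∧
    |((Λ : E4 ≃L[ℝ] E4).symm z) 1| ≤ (boostedKerrBackground Λ 0 0 0).radius z ∧
    z = (Λ : E4 ≃L[ℝ] E4) ((Λ : E4 ≃L[ℝ] E4).symm z) := by
  have hp : poincareInv Λ 0 z = (Λ : E4 ≃L[ℝ] E4).symm z := by rw [poincareInv, sub_zero]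
  refine ⟨?_, ?_, ((Λ : E4 ≃L[ℝ] E4).apply_symm_apply z).symm⟩
  · show poincareInv Λ 0 z 0 = _
    rw [hp]
  · show _ ≤ Kerr.radius 0 (poincareInv Λ 0 z)
    rw [hp, Kerr.radius_zero_left]
    set w := (Λ : E4 ≃L[ℝ] E4).symm z
    have hsq : E4.spatialNorm w ^ 2 = w 1 ^ 2 + w 2 ^ 2 + w 3 ^ 2 := E4.spatialNorm_sq w
    have hn : 0 ≤ E4.spatialNorm w := E4.spatialNorm_nonneg w
    exact abs_le_of_sq_le_sq' (by nlinarith [sq_nonneg (w 2), sq_nonneg (w 3)]) hn |>.elim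
      (fun h1 h2 ↦ abs_le.mpr ⟨h1, h2⟩)

end BandModel

open BandModel

/-- **S3a needs the orthochronous hypothesis.**  With `Λ₋ = (−1)·boost(3/5, 0, 0)`, the monotone step
wall (`2` below lab time `750`, `10⁶` from `750` on), `R₁ = 10`, `τ₁ = 0` and the band point
`x = Λ₋(0, −1000, 0, 0)` (lab time `750`), every candidate band set containing an anchor point `y`
(`r(y) = 10.5`) violates the wall at `y`. -/
theorem not_bandAnchoredPaths_without_orthochronous : ¬ BandAnchoredPathsWithoutOrthochronous := by
  intro h
  set W : ℝ → ℝ := fun s ↦ if s < 750 then 2 else 10 ^ 6 with hW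
  have hWm : Monotone W := by
    intro s s' hss'
    simp only [hW]
    split_ifs with h1 h2 h2
    · exact le_rfl
    · norm_num
    · exact absurd (lt_of_le_of_lt hss' h2) h1
    · exact le_rfl
  have hx0 : ((Λneg : E4 ≃L[ℝ] E4) xr) 0 = 750 := by rw [Λneg_apply_zero, xr_zero, xr_one]; norm_num
  obtain ⟨S, -, -, -, hS, y, hyS, hy⟩ := h Λneg 0 0 0 W 10 0 hWm anchor_ok ⟨_, mem_domain Λneg⟩
    (by rw [time_x]) (by rw [radius_x]; norm_num) (by rw [radius_x, hx0]; norm_num [hW])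
  obtain ⟨ht, -, hrW⟩ := hS y hyS
  obtain ⟨htime, hrad1, hyeq⟩ := rest_coords Λneg y
  set w := (Λneg : E4 ≃L[ℝ] E4).symm y with hw
  rw [hy] at hrW hrad1
  rw [htime] at ht
  -- the wall at `y` must be the high step: `y⁰ ≥ 750`
  have hy0 : 750 ≤ y 0 := by
    by_contra hlt
    push Not at hlt
    have : W (y 0) = 2 := by simp [hW, hlt]
    rw [this] at hrW
    norm_num at hrW
  -- `y⁰ = −(5/4) w⁰ − (3/4) w¹` with `w⁰ ≥ 0` forces `w¹ ≤ −1000`, against `|w¹| ≤ 10.5`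
  have hy0' : y 0 = -(5 / 4 * w 0) - 3 / 4 * w 1 := by
    conv_lhs => rw [hyeq]
    exact Λneg_apply_zero w
  have habs := (abs_le.mp hrad1).1
  linarith

/-- **S3a needs the monotone wall.**  With the orthochronous `Λ₊ = boost(3/5, 0, 0)`, the spike wall
(`10⁶` at lab time `−750`, `0` elsewhere), `R₁ = 10`, `τ₁ = 0` and the band point `x = Λ₊(0, −1000, 0, 0)`
(lab time `−750`), every candidate band set containing an anchor point `y` violates the wall at `y`. -/
theorem not_bandAnchoredPaths_without_monotone : ¬ BandAnchoredPathsWithoutMonotone := by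
  intro h
  set W : ℝ → ℝ := fun s ↦ if s = -750 then 10 ^ 6 else 0 with hW
  have hx0 : ((Λpos : E4 ≃L[ℝ] E4) xr) 0 = -750 := by rw [Λpos_apply_zero, xr_zero, xr_one]; norm_num
  obtain ⟨S, -, -, -, hS, y, hyS, hy⟩ := h Λpos 0 0 0 W 10 0 Λpos_orthochronous anchor_ok
    ⟨_, mem_domain Λpos⟩ (by rw [time_x]) (by rw [radius_x]; norm_num) (by rw [radius_x, hx0]; norm_num [hW])
  obtain ⟨ht, -, hrW⟩ := hS y hyS
  obtain ⟨htime, hrad1, hyeq⟩ := rest_coords Λpos y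
  set w := (Λpos : E4 ≃L[ℝ] E4).symm y with hw
  rw [hy] at hrW hrad1
  rw [htime] at ht
  -- the wall at `y` must be the spike: `y⁰ = −750`
  have hy0 : y 0 = -750 := by
    by_contra hne
    have : W (y 0) = 0 := by simp [hW, hne]
    rw [this] at hrW
    norm_num at hrW
  have hy0' : y 0 = 5 / 4 * w 0 + 3 / 4 * w 1 := by
    conv_lhs => rw [hyeq]
    exact Λpos_apply_zero w
  have habs := (abs_le.mp hrad1).1
  linarith

end Summit.FinalStateConjecture.FinalStateConjecture.Theorems.NeckGapDecay.Negative

end
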